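import Mathlib
import Summits.NavierStokesRegularity.NavierStokesRegularity.Theorems.FilamentSkeletonRssStadiumVerticalDisplacement
import Summits.NavierStokesRegularity.NavierStokesRegularity.Theorems.FilamentSkeletonRssStadiumKernelPieces
import Summits.NavierStokesRegularity.NavierStokesRegularity.Theorems.FilamentSkeletonRssNearDiagonalLogIntegral

/-!
# Route `FilamentSkeletonRss` · child crux `TangentSkeletonNearStraightL` (stmt-NavierStokesRegularity-23320) · registered line
# `child_tangent_analytic_strip_L` (b0b56c52900dd90a), stub `stub_stripPropagation` — brick: THE UNSHIFTED (FAR / PARTNER) KERNEL BOUND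

Composition of the landed pieces into the pointwise bound for the UNSHIFTED sources (R4 of the STUB-PLAN memo attached to 23320): at a complex target
point `F(x+iy) = cplx(X x) + e` (`‖eᵢ‖ ≤ 2|y|`, `Theorems.StadiumVerticalDisplacement.norm_sub_le_of_vertical_segment`) and a REAL source point
`q` at distance `d = ‖X x − q‖ ≥ 16|y|` with real unit tangent (complexified `t`, `‖t‖ ≤ 1`) and real core area `A ≥ 0`, the complexified matched
integrand `((Σᵢ(uᵢ + eᵢ)² + κA)^{3/2})⁻¹ • (t ⨯₃ (u + e))` (`u = X x − q`) is on its principal branch (`Re ≥ (d/3)²`) and has norm `≤ 61/d²`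
(`far_kernel_norm_le`).  With the linear escape `d(σ) ≥ (7/8)|σ − σ*| ∨ ρ√Γ` (`Theorems.NearStraightEscape`) this majorant is integrable in `σ` with
integral `O(1/ρ√Γ + 1/R)`, i.e. the far/partner part of `u X (X j ·)` continues with bound `O(Γθ₀⁻¹·(ρ√Γ)⁻¹) = O(√Γ)`.
HONEST FRAMING: a brick for a plan about a HYPOTHETICAL filament skeleton on the NEGATIVE side of a MODEL route; the stub `stub_stripPropagation` is NOT
closed; nothing here bears on Navier–Stokes regularity or blow-up.  `--supports stmt-NavierStokesRegularity-23320`.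
-/

set_option linter.dupNamespace false

noncomputable section

namespace Summit.NavierStokesRegularity.NavierStokesRegularity.Theorems.StadiumFarKernelBound

open Set
open scoped Matrix

/-- **Unshifted kernel bound.**  `u : ℝ³` with `‖u‖ = d > 0`, complex perturbation `e` with `‖eᵢ‖ ≤ 2|y|`, `|y| ≤ d/16`, `‖t‖ ≤ 1`, `κ, A ≥ 0`:
the real part of `Σᵢ (uᵢ + eᵢ)² + κA` is `≥ (d/3)²` and
`‖((Σᵢ (uᵢ + eᵢ)² + κA)^{3/2})⁻¹ • (t ⨯₃ (u + e))‖ ≤ 61/d²`. [folklore] -/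
theorem far_kernel_norm_le (u : EuclideanSpace ℝ (Fin 3)) (e t : Fin 3 → ℂ) {d y κ A : ℝ} (hd : 0 < d) (hu : ‖u‖ = d)
    (he : ∀ i, ‖e i‖ ≤ 2 * |y|) (hy : |y| ≤ d / 16) (ht : ‖t‖ ≤ 1) (hκ : 0 ≤ κ) (hA : 0 ≤ A) :
    (d / 3) ^ 2 ≤ ((∑ i, ((u i : ℂ) + e i) ^ 2) + ((κ * A : ℝ) : ℂ)).re ∧
    ‖(((∑ i, ((u i : ℂ) + e i) ^ 2) + ((κ * A : ℝ) : ℂ)) ^ ((3:ℂ) / 2))⁻¹ • (t ⨯₃ (fun i => (u i : ℂ) + e i))‖ ≤ 61 / d ^ 2 := by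
  have hy0 : 0 ≤ |y| := abs_nonneg y
  -- coordinates of `u`
  have hui : ∀ i, |u i| ≤ d := fun i => by
    have h := PiLp.norm_apply_le u i
    rw [Real.norm_eq_abs, hu] at h
    exact h
  have hsumsq : ∑ i, (u i) ^ 2 = d ^ 2 := by rw [← EuclideanSpace.real_norm_sq_eq, hu]
  have hsumabs : ∑ i, |u i| ≤ 3 * d := by
    simp only [Fin.sum_univ_three]
    linarith [hui 0, hui 1, hui 2]
  -- real part of the squared chord
  have hQ := Summit.NavierStokesRegularity.NavierStokesRegularity.Theorems.StadiumVerticalDisplacement.re_sum_sq_add_ge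
    (fun i => u i) e he
  have hre : (d / 3) ^ 2 ≤ ((∑ i, ((u i : ℂ) + e i) ^ 2) + ((κ * A : ℝ) : ℂ)).re := by
    rw [Complex.add_re, Complex.ofReal_re]
    have h1 : (d / 3) ^ 2 ≤ (∑ i, ((u i : ℂ) + e i) ^ 2).re := by
      refine le_trans ?_ hQ
      rw [hsumsq]
      have h2 : 2 * (2 * |y|) * ∑ i, |u i| ≤ 2 * (2 * |y|) * (3 * d) := mul_le_mul_of_nonneg_left hsumabs (by positivity)
      nlinarith [h2, hy, hd]
    have h3 : 0 ≤ κ * A := mul_nonneg hκ hA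
    linarith
  refine ⟨hre, ?_⟩
  set w : ℂ := (∑ i, ((u i : ℂ) + e i) ^ 2) + ((κ * A : ℝ) : ℂ) with hw
  have hd3 : 0 < (d / 3) ^ 2 := by positivity
  have hwpos : 0 < w.re := hd3.trans_le hre
  -- the principal-branch factor
  have hker : ‖(w ^ ((3:ℂ) / 2))⁻¹‖ ≤ ((d / 3) ^ 3)⁻¹ := by
    have h1 := Summit.NavierStokesRegularity.NavierStokesRegularity.Theorems.StadiumKernelPieces.norm_inv_cpow_threeHalves_le hwpos
    have h2 : w.re ^ (-(3/2 : ℝ)) ≤ ((d / 3) ^ 2) ^ (-(3/2 : ℝ)) := Real.rpow_le_rpow_of_nonpos hd3 hre (by norm_num)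
    have h3 : ((d / 3) ^ 2) ^ (-(3/2 : ℝ)) = ((d / 3) ^ 3)⁻¹ := by
      rw [Real.rpow_neg (sq_nonneg _),
        Summit.NavierStokesRegularity.NavierStokesRegularity.Theorems.NearDiagonalLogIntegral.rpow_threeHalves_sq (by positivity)]
    exact h1.trans (h3 ▸ h2)
  -- the numerator
  have hv : ‖(fun i => (u i : ℂ) + e i)‖ ≤ d + 2 * |y| := by
    refine (pi_norm_le_iff_of_nonneg (by positivity)).2 fun i => ?_
    calc ‖(u i : ℂ) + e i‖ ≤ ‖(u i : ℂ)‖ + ‖e i‖ := norm_add_le _ _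
      _ ≤ d + 2 * |y| := add_le_add (by rw [Complex.norm_real, Real.norm_eq_abs]; exact hui i) (he i)
  have hnum : ‖t ⨯₃ (fun i => (u i : ℂ) + e i)‖ ≤ 2 * 1 * (d + 2 * |y|) :=
    (Summit.NavierStokesRegularity.NavierStokesRegularity.Theorems.StadiumKernelPieces.norm_crossProduct_le _ _).trans
      (mul_le_mul (mul_le_mul_of_nonneg_left ht (by norm_num)) hv (norm_nonneg _) (by norm_num))
  -- assembly
  rw [norm_smul]
  have hprod : ‖(w ^ ((3:ℂ) / 2))⁻¹‖ * ‖t ⨯₃ (fun i => (u i : ℂ) + e i)‖ ≤ ((d / 3) ^ 3)⁻¹ * (2 * 1 * (d + 2 * |y|)) :=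
    mul_le_mul hker hnum (norm_nonneg _) (by positivity)
  refine hprod.trans ?_
  have h27 : ((d / 3) ^ 3)⁻¹ = 27 / d ^ 3 := by field_simp; ring
  rw [h27]
  have hyd : d + 2 * |y| ≤ 9 / 8 * d := by linarith
  calc 27 / d ^ 3 * (2 * 1 * (d + 2 * |y|)) ≤ 27 / d ^ 3 * (2 * 1 * (9 / 8 * d)) := by gcongr
    _ = (243 / 4) / d ^ 2 := by field_simp; ring
    _ ≤ 61 / d ^ 2 := by gcongr; norm_num

end Summit.NavierStokesRegularity.NavierStokesRegularity.Theorems.StadiumFarKernelBound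

end
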